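import Summits.KontsevichZagierPeriods.KontsevichZagierPeriods.Theorems.OctahedralSymmetryOctahedralSpanAllWeightsDefs
import Mathlib.LinearAlgebra.Finsupp.LSum
import Mathlib.LinearAlgebra.Span.Basic

/-!
# Crux `OctahedralSpanAllWeights` (stmt-KontsevichZagierPeriods-9659), line `Sketch`: the relation module is conjugation-stable

Complex conjugation acts on level-4 words letterwise (`LevelFour.conjWord`, poles `i ↔ −i`) and on indices
by `(s, e) ↦ (s, −e)` (`conjIdx`). This file proves that the generator set `IsGen` of the formal relation
module, hence `rel`, is stable under the induced linear map `conjQ : [W] ↦ [W̄]` (`isGen_conjQ`,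
`conjQ_mem_rel`): the involution table commutes with conjugation (`sigmaSubst_conjWord`), the word of a
conjugate index is the conjugate word (`word_conjIdx`), the level-4 stuffle and the shuffle commute with
conjugation (`stuffleIdx_conjIdx`, `shuffleWord_map`), the squaring substitution is conjugation-symmetric
(`dilSubst_conjWord`, via `ofTerms_expand_perm`: `ofTerms ∘ expand` only sees each letter table up to
permutation) and level-two words are real. This is the input of the isomorphism "real module modulo real
relations ≅ word module modulo `rel`" (`Cruxes/OctahedralSpanAllWeights/NOTES.md` §2, file `…RealForm`).
Sources: J. Zhao, Doc. Math. 15 (2010) §1–§2, §5 [Zhao2010]; J. Zhao (2008) §4 [Zhao2008].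
-/

noncomputable section

namespace Summit.KontsevichZagierPeriods.OctahedralSymmetry.OctaSpan

open Literature.NumberTheory.Transcendental Literature.NumberTheory.Transcendental.LevelFour

/-! ## Conjugation on words, indices, and the word module -/

/-- Conjugation of indices: `(s, e) ↦ (s, −e)` (`x = i^e ↦ x̄ = i^{−e}`). [cite: Zhao2010, §1] -/
def conjIdx (k : List (ℕ × Fin 4)) : List (ℕ × Fin 4) := k.map fun p => (p.1, -p.2)

/-- `conjIdx` of a cons. [folklore] -/
@[simp] theorem conjIdx_cons (p : ℕ × Fin 4) (k : List (ℕ × Fin 4)) :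
    conjIdx (p :: k) = (p.1, -p.2) :: conjIdx k := rfl

/-- `conjIdx []`. [folklore] -/
@[simp] theorem conjIdx_nil : conjIdx [] = [] := rfl

/-- Length of a conjugate index. [folklore] -/
@[simp] theorem length_conjIdx (k : List (ℕ × Fin 4)) : (conjIdx k).length = k.length := by simp [conjIdx]

/-- Conjugation on `WordQ`: `[W] ↦ [W̄]`, linearly. [folklore] -/
def conjQ : WordQ →ₗ[ℚ] WordQ := Finsupp.lmapDomain ℚ ℚ conjWord

/-- `conjQ [W] = [W̄]`. [folklore] -/
@[simp] theorem conjQ_sym (W : List (Fin 5)) : conjQ (sym W) = sym (conjWord W) := by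
  simp [conjQ, sym, Finsupp.lmapDomain_apply, Finsupp.mapDomain_single]

/-- `conjQ (toQ x) = toQ (x.mapDomain conjWord)`. [folklore] -/
theorem conjQ_toQ (x : List (Fin 5) →₀ ℤ) : conjQ (toQ x) = toQ (x.mapDomain conjWord) := by
  induction x using Finsupp.induction with
  | zero => simp
  | single_add W c f _ _ ih =>
    rw [map_add, map_add, Finsupp.mapDomain_add, map_add, ih, toQ_single, map_zsmul, conjQ_sym,
      Finsupp.mapDomain_single, toQ_single]

/-- `ofTerms` of a term list with conjugated words is the conjugate of `ofTerms`. [folklore] -/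
theorem ofTerms_map_conj (L : List (ℤ × List (Fin 5))) :
    ofTerms (L.map fun p => (p.1, conjWord p.2)) = (ofTerms L).mapDomain conjWord := by
  induction L with
  | nil => simp
  | cons p L ih => rw [List.map_cons, ofTerms_cons, ofTerms_cons, Finsupp.mapDomain_add,
      Finsupp.mapDomain_single, ih]

/-- `conjWord` commutes with `reverse`. [folklore] -/
theorem conjWord_reverse (W : List (Fin 5)) : conjWord W.reverse = (conjWord W).reverse := by
  simp [conjWord, List.map_reverse]

/-- `conjWord` of a cons. [folklore] -/
@[simp] theorem conjWord_cons (a : Fin 5) (W : List (Fin 5)) : conjWord (a :: W) = conjLetter a :: conjWord W := rfl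

/-- `conjWord []`. [folklore] -/
@[simp] theorem conjWord_nil : conjWord ([] : List (Fin 5)) = [] := rfl

/-- `conjWord` of an append. [folklore] -/
@[simp] theorem conjWord_append (u v : List (Fin 5)) : conjWord (u ++ v) = conjWord u ++ conjWord v := by
  simp [conjWord]

/-- Length of the conjugate word. [folklore] -/
@[simp] theorem length_conjWord (W : List (Fin 5)) : (conjWord W).length = W.length := by simp [conjWord]

/-! ## Convergence is conjugation-invariant -/

/-- `conjLetter a = 0 ↔ a = 0` and `conjLetter a = 4 ↔ a = 4`. [folklore] -/
theorem conjLetter_eq_zero_iff (a : Fin 5) : conjLetter a = 0 ↔ a = 0 := by fin_cases a <;> decide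

/-- [folklore] -/
theorem conjLetter_eq_four_iff (a : Fin 5) : conjLetter a = 4 ↔ a = 4 := by fin_cases a <;> decide

/-- **Conjugate words are convergent iff the words are.** [folklore] -/
theorem isConvergent_conjWord {W : List (Fin 5)} (hW : IsConvergent W) : IsConvergent (conjWord W) := by
  constructor
  · intro h
    cases W with
    | nil => simp at h
    | cons a W =>
      have : conjLetter a = 0 := by simpa using h
      exact hW.1 (by simp [(conjLetter_eq_zero_iff a).1 this])
  · intro h
    rw [conjWord, List.getLast?_map] at h
    cases hL : W.getLast? with
    | none => simp [hL] at h
    | some a =>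
      rw [hL] at h
      have : conjLetter a = 4 := by simpa using h
      exact hW.2 (by rw [hL, (conjLetter_eq_four_iff a).1 this])

/-- Conjugate indices are convergent iff the indices are. [folklore] -/
theorem isConvergentIdx_conjIdx {k : List (ℕ × Fin 4)} (hk : IsConvergentIdx k) : IsConvergentIdx (conjIdx k) := by
  constructor
  · intro p hp
    obtain ⟨q, hq, rfl⟩ := List.mem_map.1 hp
    exact hk.1 q hq
  · intro p hp
    cases k with
    | nil => simp [conjIdx] at hp
    | cons q k =>
      simp only [conjIdx, List.map_cons, List.head?_cons, Option.mem_def, Option.some.injEq] at hp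
      subst hp
      intro h
      have hq : q ≠ (1, 0) := hk.2 q (by simp)
      apply hq
      have h1 : q.1 = 1 := by have := congrArg Prod.fst h; simpa using this
      have h2 : -q.2 = 0 := by have := congrArg Prod.snd h; simpa using this
      exact Prod.ext h1 (by simpa using h2)

/-- Level-two words are fixed by conjugation. [folklore] -/
theorem conjWord_of_isLevelTwo {W : List (Fin 5)} (h : IsLevelTwo W) : conjWord W = W := by
  induction W with
  | nil => rfl
  | cons a W ih =>
    have ha : conjLetter a = a := by rcases h a (by simp) with rfl | rfl | rfl <;> rfl
    rw [conjWord_cons, ha, ih fun b hb => h b (by simp [hb])]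

/-! ## The word of a conjugate index -/

/-- `conjLetter (castSucc x) = castSucc (−x)` on the poles `i^x`. [folklore] -/
theorem conjLetter_castSucc (x : Fin 4) : conjLetter (Fin.castSucc x) = Fin.castSucc (-x) := by
  fin_cases x <;> rfl

/-- `wordAux` of a conjugate index (accumulated exponent negated) is the conjugate word. [folklore] -/
theorem wordAux_conjIdx (k : List (ℕ × Fin 4)) : ∀ acc : Fin 4,
    wordAux (-acc) (conjIdx k) = conjWord (wordAux acc k) := by
  induction k with
  | nil => intro acc; rfl
  | cons p k ih =>
    intro acc
    rw [conjIdx_cons, wordAux, wordAux, conjWord_append, conjWord_append]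
    dsimp only
    rw [show -acc + -p.2 = -(acc + p.2) from (neg_add acc p.2).symm, ih (acc + p.2)]
    congr 1
    congr 1
    · simp [conjWord, show conjLetter 4 = 4 from rfl]
    · rw [conjWord_cons, conjWord_nil, conjLetter_castSucc]

/-- **`word (conjIdx k) = conjWord (word k)`.** [cite: Zhao2010, §2] -/
theorem word_conjIdx (k : List (ℕ × Fin 4)) : word (conjIdx k) = conjWord (word k) := by
  have := wordAux_conjIdx k 0
  rwa [neg_zero] at this

/-! ## Shuffles and stuffles of conjugates -/

/-- Mapping letters commutes with the shuffle of words. [folklore] -/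
theorem shuffleWord_map {α β : Type*} (f : α → β) : ∀ (u v : List α),
    MZV.shuffleWord (u.map f) (v.map f) = (MZV.shuffleWord u v).map (List.map f)
  | [], v => by simp
  | a :: u, [] => by simp
  | a :: u, b :: v => by
    have h1 := shuffleWord_map f u (b :: v)
    have h2 := shuffleWord_map f (a :: u) v
    simp only [List.map_cons] at h1 h2 ⊢
    rw [MZV.shuffleWord_cons_cons, MZV.shuffleWord_cons_cons, h1, h2]
    simp [List.map_append, List.map_map, Function.comp_def]

/-- `shuffle (conj u) (conj v) = conj (shuffle u v)`. [folklore] -/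
theorem shuffle_conjWord (u v : List (Fin 5)) :
    shuffle (conjWord u) (conjWord v) = (shuffle u v).mapDomain conjWord := by
  rw [shuffle, shuffle, conjWord, conjWord, shuffleWord_map, ← ofTerms_map_conj, List.map_map, List.map_map]
  rfl

/-- The level-4 stuffle of conjugate indices. [cite: Zhao2010, Def. 2.4] -/
theorem stuffleIdx_conjIdx : ∀ (k l : List (ℕ × Fin 4)),
    stuffleIdx (conjIdx k) (conjIdx l) = (stuffleIdx k l).map conjIdx
  | [], l => by simp
  | p :: k, [] => by simp
  | p :: k, q :: l => by
    have e1 := stuffleIdx_conjIdx k (q :: l)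
    have e2 := stuffleIdx_conjIdx (p :: k) l
    have e3 := stuffleIdx_conjIdx k l
    simp only [conjIdx_cons] at e1 e2 e3 ⊢
    rw [stuffleIdx_cons_cons, stuffleIdx_cons_cons, e1, e2, e3]
    simp only [List.map_append, List.map_map, Function.comp_def, conjIdx_cons, neg_add]

/-- `stuffleSigned` of conjugate indices is the conjugate. [cite: Zhao2010, §2] -/
theorem stuffleSigned_conjIdx (k l : List (ℕ × Fin 4)) :
    stuffleSigned (conjIdx k) (conjIdx l) = (stuffleSigned k l).mapDomain conjWord := by
  rw [stuffleSigned, stuffleSigned, stuffleIdx_conjIdx, ← ofTerms_map_conj, List.map_map, List.map_map]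
  congr 1
  refine List.map_congr_left fun m _ => ?_
  simp only [Function.comp_apply, length_conjIdx, word_conjIdx]

/-! ## Letter substitutions of conjugates -/

/-- Multilinear expansion of a conjugate word under a conjugation-equivariant table. [folklore] -/
theorem expand_conjWord (φ : Fin 5 → List (ℤ × Fin 5))
    (hφ : ∀ a, φ (conjLetter a) = (φ a).map fun cb => (cb.1, conjLetter cb.2)) :
    ∀ W : List (Fin 5), expand φ (conjWord W) = (expand φ W).map fun t => (t.1, conjWord t.2)
  | [] => rfl
  | a :: W => by
    rw [conjWord_cons, expand_cons, expand_cons, hφ, expand_conjWord φ hφ W]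
    simp [List.flatMap_map, List.map_flatMap, List.map_map, Function.comp_def]

/-- The involution table is conjugation-equivariant. [cite: Zhao2008, §4] -/
theorem sigmaLetter_conj (a : Fin 5) :
    sigmaLetter (conjLetter a) = (sigmaLetter a).map fun cb => (cb.1, conjLetter cb.2) := by
  fin_cases a <;> rfl

/-- **`sigmaSubst (conj W) = conj (sigmaSubst W)`.** [cite: Zhao2008, §4] -/
theorem sigmaSubst_conjWord (W : List (Fin 5)) :
    sigmaSubst (conjWord W) = (sigmaSubst W).mapDomain conjWord := by
  rw [sigmaSubst, sigmaSubst, length_conjWord, expand_conjWord sigmaLetter sigmaLetter_conj,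
    Finsupp.mapDomain_smul, ← ofTerms_map_conj, List.map_map, List.map_map]
  congr 2
  refine List.map_congr_left fun t _ => ?_
  simp [conjWord_reverse]

/-- Multilinear expansion under a table mapped letterwise by `g`. [folklore] -/
theorem expand_map_letters (φ : Fin 5 → List (ℤ × Fin 5)) (g : Fin 5 → Fin 5) :
    ∀ W : List (Fin 5), expand (fun a => (φ a).map fun cb => (cb.1, g cb.2)) W =
      (expand φ W).map fun t => (t.1, t.2.map g)
  | [] => rfl
  | a :: W => by
    rw [expand_cons, expand_cons, expand_map_letters φ g W]
    simp [List.flatMap_map, List.map_flatMap, List.map_map, Function.comp_def]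

/-- `ofTerms ∘ expand` only depends on each `φ a` up to permutation. [folklore] -/
theorem ofTerms_expand_perm (φ ψ : Fin 5 → List (ℤ × Fin 5)) (h : ∀ a, (φ a).Perm (ψ a)) :
    ∀ W : List (Fin 5), ofTerms (expand φ W) = ofTerms (expand ψ W)
  | [] => rfl
  | a :: W => by
    rw [expand_cons, expand_cons]
    have key : ∀ (cb : ℤ × Fin 5), ofTerms ((expand φ W).map fun dV => (cb.1 * dV.1, cb.2 :: dV.2)) =
        ofTerms ((expand ψ W).map fun dV => (cb.1 * dV.1, cb.2 :: dV.2)) := by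
      intro cb
      have aux : ∀ L : List (ℤ × List (Fin 5)), ofTerms (L.map fun dV => (cb.1 * dV.1, cb.2 :: dV.2)) =
          cb.1 • (ofTerms L).mapDomain (List.cons cb.2) := by
        intro L
        induction L with
        | nil => simp
        | cons t L ih =>
          rw [List.map_cons, ofTerms_cons, ofTerms_cons, ih, Finsupp.mapDomain_add, smul_add,
            Finsupp.mapDomain_single, Finsupp.smul_single, smul_eq_mul]
      rw [aux, aux, ofTerms_expand_perm φ ψ h W]
    have hsum : ∀ (L : List (ℤ × Fin 5)), ofTerms (L.flatMap fun cb => (expand φ W).map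
        fun dV => (cb.1 * dV.1, cb.2 :: dV.2)) = (L.map fun cb => ofTerms ((expand ψ W).map
        fun dV => (cb.1 * dV.1, cb.2 :: dV.2))).sum := by
      intro L
      induction L with
      | nil => simp
      | cons cb L ih => rw [List.flatMap_cons, ofTerms_append, ih, key, List.map_cons, List.sum_cons]
    have hsum' : ∀ (L : List (ℤ × Fin 5)), ofTerms (L.flatMap fun cb => (expand ψ W).map
        fun dV => (cb.1 * dV.1, cb.2 :: dV.2)) = (L.map fun cb => ofTerms ((expand ψ W).map
        fun dV => (cb.1 * dV.1, cb.2 :: dV.2))).sum := by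
      intro L
      induction L with
      | nil => simp
      | cons cb L ih => rw [List.flatMap_cons, ofTerms_append, ih, List.map_cons, List.sum_cons]
    rw [hsum, hsum', ((h a).map _).sum_eq]

/-- The squaring table is conjugation-invariant up to the order of its entries. [cite: Zhao2010, §5] -/
theorem dilLetter_conj_perm (a : Fin 5) :
    ((dilLetter a).map fun cb => (cb.1, conjLetter cb.2)).Perm (dilLetter (conjLetter a)) := by
  fin_cases a
  · exact List.Perm.refl _
  · exact List.Perm.refl _
  · exact List.Perm.swap _ _ []
  · exact List.Perm.refl _
  · exact List.Perm.refl _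

/-- **`dilSubst (conj W) = conj (dilSubst W)`** (for every word; used for level-two words, which are
conjugation-fixed). [cite: Zhao2010, §5] -/
theorem dilSubst_conjWord (W : List (Fin 5)) :
    dilSubst (conjWord W) = (dilSubst W).mapDomain conjWord := by
  rw [dilSubst, dilSubst, ← ofTerms_map_conj]
  have h1 : (expand dilLetter W).map (fun p => (p.1, conjWord p.2)) =
      expand (fun a => (dilLetter a).map fun cb => (cb.1, conjLetter cb.2)) W := by
    rw [expand_map_letters]; rfl
  rw [h1, conjWord]
  -- `conjWord W = W.map conjLetter`; expand the conjugated word under `dilLetter` = expand `W` under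
  -- the table `a ↦ dilLetter (conjLetter a)`
  have h2 : ∀ V : List (Fin 5), expand dilLetter (V.map conjLetter) =
      expand (fun a => dilLetter (conjLetter a)) V := by
    intro V
    induction V with
    | nil => rfl
    | cons a V ih => rw [List.map_cons, expand_cons, expand_cons, ih]
  rw [h2]
  exact (ofTerms_expand_perm _ _ (fun a => (dilLetter_conj_perm a)) W).symm

/-! ## The generators and the relation module are conjugation-stable -/

/-- `conjQ (liftMap u ρ) = liftMap (conj u) (conjQ ρ)`. [folklore] -/
theorem conjQ_liftMap (u : List (Fin 5)) (ρ : WordQ) :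
    conjQ (liftMap u ρ) = liftMap (conjWord u) (conjQ ρ) := by
  have h : conjQ ∘ₗ liftMap u = liftMap (conjWord u) ∘ₗ conjQ := by
    refine Finsupp.lhom_ext' fun V => LinearMap.ext_ring ?_
    simp only [LinearMap.coe_comp, Function.comp_apply, Finsupp.lsingle_apply]
    rw [show Finsupp.single V (1 : ℚ) = sym V from rfl, conjQ_sym]
    simp [liftMap, sym, conjQ_toQ, shuffle_conjWord]
  exact LinearMap.congr_fun h ρ

/-- **Conjugates of generators are generators.** [cite: Zhao2010, §2] -/
theorem isGen_conjQ {ρ : WordQ} (h : IsGen ρ) : IsGen (conjQ ρ) := by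
  induction h with
  | inv hW =>
    rw [invGen, map_sub, conjQ_sym, conjQ_toQ, ← sigmaSubst_conjWord]
    exact IsGen.inv (isConvergent_conjWord hW)
  | fds hk hl =>
    rw [fdsGen, map_sub, conjQ_toQ, conjQ_toQ, ← stuffleSigned_conjIdx, ← shuffle_conjWord, ← word_conjIdx,
      ← word_conjIdx]
    exact IsGen.fds (isConvergentIdx_conjIdx hk) (isConvergentIdx_conjIdx hl)
  | dil hW h2 =>
    rw [dilGen, map_sub, conjQ_sym, conjQ_toQ, ← dilSubst_conjWord, conjWord_of_isLevelTwo h2]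
    exact IsGen.dil hW h2
  | lift hu _ ih =>
    rw [conjQ_liftMap]
    exact IsGen.lift (isConvergent_conjWord hu) ih

/-- **The relation module is conjugation-stable.** [cite: Zhao2010, §2] -/
theorem conjQ_mem_rel {ρ : WordQ} (h : ρ ∈ rel) : conjQ ρ ∈ rel := by
  have : Submodule.map conjQ rel ≤ rel := by
    rw [rel, Submodule.map_span_le]
    exact fun x hx => mem_rel_of_isGen (isGen_conjQ hx)
  exact this (Submodule.mem_map_of_mem h)

end Summit.KontsevichZagierPeriods.OctahedralSymmetry.OctaSpan

end
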